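import Mathlib
import Literature.Computability.AlgebraicComplexity.JointCircuits
import Literature.Computability.AlgebraicComplexity.FFTCircuitCost
import Literature.Computability.AlgebraicComplexity.FastSeriesCircuits
import Literature.Computability.AlgebraicComplexity.SeriesInverseCircuit
import Literature.Computability.AlgebraicComplexity.SeriesExpODE
import HarnessLib

/-!
# Newton iteration for `y' = w y` (the exponential of a power series), as a circuit

Topic `Computability/AlgebraicComplexity`, namespace `Literature.Computability.AlgebraicComplexity`.
Everything PROVED; two bookkeeping definitions (`expStepCost`, `expCost`: gate counts), no named facts.

The circuit layer of `SeriesExpODE.lean` (Brent 1976 §§5–6 / Brent–Kung: the solution of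
`y' = w y`, `y(0) = 1`, i.e. `y = exp ∫ w`, by the doubling `y₁ = y₀ (1 + ∫ (w − y₀' y₀^{-1}))`), in the
tree's circuit model (`complexity`; `JointlyComputed`; fast multiplication `jointlyComputed_lconv`;
Newton inversion `jointlyComputed_inv`):

* `jointlyComputed_expODE_step` : from the first `2^i` coefficients of `y` and the first `2^{i+1}`
  coefficients of `w`, the first `2^{i+1}` coefficients of `y` in `expStepCost i` gates (one Newton
  inversion of the truncation `y₀`, two fast multiplications, `7 · 2^i` scalings / additions);
* `jointlyComputed_expODE` : the first `2^J` coefficients of `y` in `expCost J` gates, given the first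
  `2^J` coefficients of `w`; `expStepCost_le`, `expCost_le` : `expCost J ≤ (72 J + 251) 2^{J+1}`.

Intended consumer: separable coefficient tensors with GENERIC univariate tables
(`∏_l g_l(x_l s)` solves `y' = W y` with `W = Σ_l x_l (g_l'/g_l)(x_l s)`; cost `≈ 2n²` for the
coefficients of `W` plus `expCost`).

## References

* R. P. Brent, *Fast multiple-precision evaluation of elementary functions*, J. ACM 23 (1976), §§5–6.
  [Brent1976]
* J. von zur Gathen, J. Gerhard, *Modern Computer Algebra*, CUP (3rd ed. 2013), §9.1. [GathenGerhard2013]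
-/

noncomputable section

open MvPolynomial

namespace Literature.Computability.AlgebraicComplexity

section ExpODECircuit

universe uu vv ww

variable {k : Type uu} [CommRing k] {τ : Type vv}

open _root_.Finset _root_.PowerSeries

/-- `lconv` reads its arguments only up to the output index. [folklore] -/
private theorem lconv_congr_le₃ {S : Type*} [CommSemiring S] {a a' b b' : ℕ → S} {m : ℕ}
    (ha : ∀ i ≤ m, a i = a' i) (hb : ∀ j ≤ m, b j = b' j) : lconv a b m = lconv a' b' m := by
  unfold lconv
  refine sum_congr rfl fun ij hij => ?_
  rw [Finset.HasAntidiagonal.mem_antidiagonal] at hij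
  rw [ha ij.1 (by omega), hb ij.2 (by omega)]

/-- The linear convolution of coefficient sequences of power series is the coefficient sequence
of the product. [folklore] -/
private theorem lconv_coeff_eq_coeff_mul₃ {S : Type*} [CommSemiring S] (φ ψ : S⟦X⟧) (m : ℕ) :
    lconv (fun i => coeff i φ) (fun j => coeff j ψ) m = coeff m (φ * ψ) := by
  rw [PowerSeries.coeff_mul]; rfl

/-- Gate count of one doubling step for `y' = w y` at precision `2^i → 2^{i+1}`.
[cite: Brent1976, §6] -/
def expStepCost (i : ℕ) : ℕ := invCost (i + 1) + (3 * i + 8) * 2 ^ (i + 3) + 7 * 2 ^ i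

/-- `expStepCost i ≤ (72 i + 251) 2^i`. [cite: Brent1976, §6] -/
theorem expStepCost_le (i : ℕ) : expStepCost i ≤ (72 * i + 251) * 2 ^ i := by
  have h := invCost_le (i + 1)
  rw [expStepCost]
  have h4 : 2 ^ (i + 1 + 1) = 4 * 2 ^ i := by rw [pow_succ, pow_succ]; ring
  have h8 : 2 ^ (i + 3) = 8 * 2 ^ i := by rw [pow_succ, pow_succ, pow_succ]; ring
  rw [h4] at h
  rw [h8]
  nlinarith [h, Nat.zero_le (2 ^ i), Nat.zero_le i]

/-- **One doubling step for `y' = w y` as a circuit** (Brent 1976 / Brent–Kung, cost with fast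
multiplication; Bürgisser's model): if the first `2^{i+1}` coefficients of `w` and the first `2^i`
coefficients of the solution `y` (`y' = w y`, `y(0) = 1`) are read off a jointly computed family
within `s` gates, then so are the first `2^{i+1}` coefficients of `y` within `s + expStepCost i`
gates: invert the truncation `y₀` (`jointlyComputed_inv`), form `y₀'`, `e = w − y₀' y₀^{-1}`,
`E = ∫ e`, and `y₀ + y₀ E` (`coeff_newton_expODE`). Needs inverses `ninv j` of `j + 1` in `k`.
[cite: Brent1976, §6] -/
theorem jointlyComputed_expODE_step (ζ tinv : ℕ → k)
    (hζ : ∀ κ, κ ≠ 0 → ζ κ ^ 2 ^ (κ - 1) = -1) (ht : ∀ κ, (2 ^ κ : k) * tinv κ = 1)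
    (ninv : ℕ → k) (hninv : ∀ j : ℕ, ((j : k) + 1) * ninv j = 1)
    {ι : Type ww} {v : ι → MvPolynomial τ k} {s : ℕ} (hv : JointlyComputed v s)
    (w y : (MvPolynomial τ k)⟦X⟧) (hy : derivativeFun y = w * y) (hy0 : coeff 0 y = 1)
    (i : ℕ) (eW : Fin (2 ^ (i + 1)) → ι) (heW : ∀ j, v (eW j) = coeff j w)
    (er : Fin (2 ^ i) → ι) (her : ∀ j, v (er j) = coeff j y) :
    JointlyComputed (Sum.elim v (fun m : Fin (2 ^ (i + 1)) => coeff m y)) (s + expStepCost i) := by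
  classical
  have hM1 : 1 ≤ 2 ^ i := Nat.one_le_two_pow
  have h2M : 2 ^ (i + 1) = 2 * 2 ^ i := by rw [pow_succ, mul_comm]
  have h4M : 2 ^ (i + 2) = 4 * 2 ^ i := by rw [pow_add]; ring
  have hninvS : ∀ j : ℕ, ((j : MvPolynomial τ k) + 1) * MvPolynomial.C (ninv j) = 1 := fun j => by
    rw [show ((j : MvPolynomial τ k) + 1) = MvPolynomial.C ((j : k) + 1) by simp,
      ← MvPolynomial.C_mul, hninv, MvPolynomial.C_1]
  -- the truncation `Y₀` of `y`, its coefficient sequence `r`, and its inverse `Q`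
  let r : ℕ → MvPolynomial τ k := fun m => if m < 2 ^ i then coeff m y else 0
  let Y₀ : (MvPolynomial τ k)⟦X⟧ := PowerSeries.mk r
  have hRc : ∀ m, coeff m Y₀ = r m := fun m => PowerSeries.coeff_mk _ _
  have hR : ∀ j < 2 ^ i, coeff j Y₀ = coeff j y := fun j hj => by rw [hRc]; exact if_pos hj
  have hr0 : ∀ m, 2 ^ i ≤ m → r m = 0 := fun m hm => if_neg (not_lt.2 hm)
  have her' : ∀ j : Fin (2 ^ i), v (er j) = r j := fun j => by
    rw [her]; exact (if_pos j.isLt).symm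
  have hY0 : PowerSeries.constantCoeff Y₀ = ((1 : (MvPolynomial τ k)ˣ) : MvPolynomial τ k) := by
    rw [Units.val_one, ← PowerSeries.coeff_zero_eq_constantCoeff_apply, hR 0 hM1, hy0]
  let Q : (MvPolynomial τ k)⟦X⟧ := Y₀.invOfUnit 1
  have hQ : Q * Y₀ = 1 := by rw [mul_comm]; exact PowerSeries.mul_invOfUnit Y₀ 1 hY0
  have hQ0 : coeff 0 Q = 1 := by
    rw [PowerSeries.coeff_zero_eq_constantCoeff_apply, PowerSeries.constantCoeff_invOfUnit]
    simp
  -- step 1: the first `2^{i+1}` coefficients of `Q` by Newton inversion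
  have hP : ∀ j, 2 ^ i - 1 < j → coeff j Y₀ = 0 := fun j hj => by rw [hRc]; exact hr0 j (by omega)
  have h1 := jointlyComputed_inv ζ tinv hζ ht Q Y₀ hQ hQ0 (2 ^ i - 1) hP (i + 1) v s
    (fun j => er ⟨j, by have := j.isLt; omega⟩) hv (fun j => by
      simp only [hRc]; exact her' ⟨j, _⟩)
  -- step 2: the derivative `Y₀'`: entries `(m+1) • r (m+1)`, `m < 2^i`
  let w₁ : (ι ⊕ Fin (2 ^ (i + 1))) ⊕ Fin (2 ^ i) → MvPolynomial τ k :=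
    Sum.elim (Sum.elim v (fun m : Fin (2 ^ (i + 1)) => coeff m Q)) (fun m => r (m + 1))
  have hw₁ : JointlyComputed w₁ (s + invCost (i + 1)) := by
    refine h1.of_mem _ ?_
    rintro (x | m)
    · exact Or.inl ⟨x, rfl⟩
    · by_cases hm : (m : ℕ) + 1 < 2 ^ i
      · exact Or.inl ⟨Sum.inl (er ⟨m + 1, hm⟩), by simp [w₁, her']⟩
      · exact Or.inr (Or.inr ⟨0, by simp [w₁, r, hm]⟩)
  have h2 := hw₁.extend_smul (κ := Fin (2 ^ i)) (fun m => ((m : ℕ) : k) + 1) (fun m => Sum.inr m)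
  rw [Fintype.card_fin] at h2
  set d : ℕ → MvPolynomial τ k := fun m => coeff m (derivativeFun Y₀) with hd
  have hd' : ∀ m, d m = r (m + 1) * ((m : MvPolynomial τ k) + 1) := fun m => by
    rw [hd]
    dsimp only
    rw [coeff_derivativeFun, hRc]
  have hd0 : ∀ m, 2 ^ i ≤ m → d m = 0 := fun m hm => by rw [hd', hr0 (m + 1) (by omega), zero_mul]
  -- step 3: `u = Y₀' ∗ Q` below `2^{i+1}` (transform length `2^{i+2}`)
  let q' : ℕ → MvPolynomial τ k := fun j => if j < 2 ^ (i + 1) then coeff j Q else 0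
  have h3 := jointlyComputed_lconv h2 (κ := i + 2) (Nat.succ_ne_zero _)
    (hζ _ (Nat.succ_ne_zero _)) (ht _) d q' (la := 2 ^ i) (lb := 2 ^ (i + 1)) hd0
    (fun j hj => if_neg (by omega)) (by rw [h4M, h2M]; omega)
    (fun j => Sum.inr j) (fun j => Sum.inl (Sum.inl (Sum.inr j)))
    (fun j => by
      simp only [Sum.elim_inr, w₁, hd', MvPolynomial.smul_eq_C_mul, map_add, map_natCast, map_one]
      ring)
    (fun j => by simp [w₁, q', j.isLt])
  set u : ℕ → MvPolynomial τ k := lconv d q' with hu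
  have hu' : ∀ m < 2 ^ (i + 1), u m = coeff m (derivativeFun Y₀ * Q) := by
    intro m hm
    rw [hu, ← lconv_coeff_eq_coeff_mul₃]
    exact lconv_congr_le₃ (fun j _ => rfl) (fun j hj => if_pos (by omega))
  -- step 4: `e = w − u` below `2^{i+1}`
  have h4 := h3.extend_wadd (κ := Fin (2 ^ (i + 1))) (fun _ => (1 : k)) (fun _ => (-1 : k))
    (fun m => Sum.inl (Sum.inl (Sum.inl (Sum.inl (eW m)))))
    (fun m => Sum.inr ⟨m, by have h1 : (m : ℕ) < 2 ^ (i + 1) := m.isLt; omega⟩)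
  rw [Fintype.card_fin] at h4
  set e : (MvPolynomial τ k)⟦X⟧ := w - derivativeFun Y₀ * Q with he
  have he' : ∀ m : Fin (2 ^ (i + 1)), (1 : k) • v (eW m) + (-1 : k) • u m = coeff m e := by
    intro m
    rw [heW, hu' m m.isLt, he, map_sub, one_smul, neg_one_smul, sub_eq_add_neg]
  -- step 5: `E = ∫ e` below `2^{i+1}`
  set E : (MvPolynomial τ k)⟦X⟧ := integ (fun j => MvPolynomial.C (ninv j)) e with hE
  let w₅ : (((((ι ⊕ Fin (2 ^ (i + 1))) ⊕ Fin (2 ^ i)) ⊕ Fin (2 ^ i)) ⊕ Fin (2 ^ (i + 2))) ⊕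
      Fin (2 ^ (i + 1))) ⊕ Fin (2 ^ (i + 1)) → MvPolynomial τ k :=
    Sum.elim (Sum.elim (Sum.elim (Sum.elim w₁
      (fun m : Fin (2 ^ i) => (((m : ℕ) : k) + 1) • w₁ (Sum.inr m)))
      (fun m : Fin (2 ^ (i + 2)) => u m))
      (fun m : Fin (2 ^ (i + 1)) => coeff m e))
      (fun m : Fin (2 ^ (i + 1)) => if (m : ℕ) = 0 then (0 : MvPolynomial τ k)
        else coeff ((m : ℕ) - 1) e)
  have hw₅ : JointlyComputed w₅ (s + invCost (i + 1) + 2 ^ i + (3 * (i + 2) + 2) * 2 ^ (i + 2) +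
      2 ^ (i + 1)) := by
    refine h4.of_mem _ ?_
    rintro ((x | m) | m)
    · exact Or.inl ⟨Sum.inl x, rfl⟩
    · exact Or.inl ⟨Sum.inr m, (he' m).symm⟩
    · by_cases hm : (m : ℕ) = 0
      · refine Or.inr (Or.inr ⟨0, ?_⟩)
        show (if (m : ℕ) = 0 then (0 : MvPolynomial τ k) else coeff ((m : ℕ) - 1) e) = _
        rw [if_pos hm, map_zero]
      · refine Or.inl ⟨Sum.inr ⟨(m : ℕ) - 1, by have := m.isLt; omega⟩, ?_⟩
        show (if (m : ℕ) = 0 then (0 : MvPolynomial τ k) else coeff ((m : ℕ) - 1) e) = _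
        rw [if_neg hm]
        exact (he' ⟨(m : ℕ) - 1, _⟩).symm
  have h5 := hw₅.extend_smul (κ := Fin (2 ^ (i + 1)))
    (fun m => if (m : ℕ) = 0 then (0 : k) else ninv ((m : ℕ) - 1)) (fun m => Sum.inr m)
  rw [Fintype.card_fin] at h5
  have hE' : ∀ m : Fin (2 ^ (i + 1)),
      (if (m : ℕ) = 0 then (0 : k) else ninv ((m : ℕ) - 1)) • w₅ (Sum.inr m) = coeff m E := by
    intro m
    have hw5 : w₅ (Sum.inr m) =
        (if (m : ℕ) = 0 then (0 : MvPolynomial τ k) else coeff ((m : ℕ) - 1) e) := rfl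
    by_cases hm : (m : ℕ) = 0
    · rw [if_pos hm, zero_smul, hm, hE, coeff_zero_integ]
    · obtain ⟨j, hj⟩ : ∃ j, (m : ℕ) = j + 1 := ⟨(m : ℕ) - 1, by omega⟩
      rw [hw5, MvPolynomial.smul_eq_C_mul, hj, if_neg (Nat.succ_ne_zero j),
        if_neg (Nat.succ_ne_zero j), Nat.add_sub_cancel, hE, coeff_succ_integ]
  -- step 6: `p = Y₀ ∗ E` below `2^{i+1}` (transform length `2^{i+2}`)
  let E' : ℕ → MvPolynomial τ k := fun j => if j < 2 ^ (i + 1) then coeff j E else 0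
  have h6 := jointlyComputed_lconv h5 (κ := i + 2) (Nat.succ_ne_zero _)
    (hζ _ (Nat.succ_ne_zero _)) (ht _) r E' (la := 2 ^ i) (lb := 2 ^ (i + 1)) hr0
    (fun j hj => if_neg (by omega)) (by rw [h4M, h2M]; omega)
    (fun j => Sum.inl (Sum.inl (Sum.inl (Sum.inl (Sum.inl (Sum.inl (Sum.inl (er j))))))))
    (fun j => Sum.inr j)
    (fun j => by simp [w₅, w₁, her'])
    (fun j => by simp only [Sum.elim_inr, hE', E', if_pos j.isLt])
  set p : ℕ → MvPolynomial τ k := lconv r E' with hp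
  have hp' : ∀ m < 2 ^ (i + 1), p m = coeff m (Y₀ * E) := by
    intro m hm
    rw [hp, ← lconv_coeff_eq_coeff_mul₃]
    exact lconv_congr_le₃ (fun j _ => (hRc j).symm) (fun j hj => if_pos (by omega))
  -- step 7: `z = Y₀ + p` below `2^{i+1}`
  let w₇ : ((((((((ι ⊕ Fin (2 ^ (i + 1))) ⊕ Fin (2 ^ i)) ⊕ Fin (2 ^ i)) ⊕ Fin (2 ^ (i + 2))) ⊕
      Fin (2 ^ (i + 1))) ⊕ Fin (2 ^ (i + 1))) ⊕ Fin (2 ^ (i + 1))) ⊕ Fin (2 ^ (i + 2))) ⊕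
      (Fin (2 ^ (i + 1)) ⊕ Fin (2 ^ (i + 1))) → MvPolynomial τ k :=
    Sum.elim (Sum.elim (Sum.elim w₅ (fun m : Fin (2 ^ (i + 1)) => coeff m E))
      (fun m : Fin (2 ^ (i + 2)) => p m))
      (Sum.elim (fun m : Fin (2 ^ (i + 1)) => r m) (fun m : Fin (2 ^ (i + 1)) => p m))
  have hw₇ : JointlyComputed w₇ (s + invCost (i + 1) + 2 ^ i + (3 * (i + 2) + 2) * 2 ^ (i + 2) +
      2 ^ (i + 1) + 2 ^ (i + 1) + (3 * (i + 2) + 2) * 2 ^ (i + 2)) := by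
    refine h6.of_mem _ ?_
    rintro ((x | m) | (m | m))
    · rcases x with x | m
      · exact Or.inl ⟨Sum.inl (Sum.inl x), rfl⟩
      · exact Or.inl ⟨Sum.inl (Sum.inr m), (hE' m).symm⟩
    · exact Or.inl ⟨Sum.inr m, rfl⟩
    · by_cases hm : (m : ℕ) < 2 ^ i
      · exact Or.inl ⟨Sum.inl (Sum.inl (Sum.inl (Sum.inl (Sum.inl (Sum.inl (Sum.inl (Sum.inl
          (er ⟨m, hm⟩)))))))), (her' ⟨m, hm⟩).symm⟩
      · refine Or.inr (Or.inr ⟨0, ?_⟩)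
        show r m = _
        rw [map_zero]
        exact hr0 m (not_lt.1 hm)
    · exact Or.inl ⟨Sum.inr ⟨m, by have h1 : (m : ℕ) < 2 ^ (i + 1) := m.isLt; omega⟩, rfl⟩
  have h7 := hw₇.extend_wadd (κ := Fin (2 ^ (i + 1))) (fun _ => (1 : k)) (fun _ => (1 : k))
    (fun m => Sum.inr (Sum.inl m)) (fun m => Sum.inr (Sum.inr m))
  rw [Fintype.card_fin] at h7
  have hcost : s + invCost (i + 1) + 2 ^ i + (3 * (i + 2) + 2) * 2 ^ (i + 2) + 2 ^ (i + 1) +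
      2 ^ (i + 1) + (3 * (i + 2) + 2) * 2 ^ (i + 2) + 2 ^ (i + 1) = s + expStepCost i := by
    rw [expStepCost, h4M, h2M, show 2 ^ (i + 3) = 8 * 2 ^ i by rw [pow_add]; ring]; ring
  rw [hcost] at h7
  refine h7.of_mem _ ?_
  rintro (x | m)
  · exact Or.inl ⟨Sum.inl (Sum.inl (Sum.inl (Sum.inl (Sum.inl (Sum.inl (Sum.inl (Sum.inl
      (Sum.inl (Sum.inl x))))))))), rfl⟩
  · have hm : (m : ℕ) < 2 ^ (i + 1) := m.isLt
    refine Or.inl ⟨Sum.inr m, ?_⟩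
    simp only [Sum.elim_inr, w₇, Sum.elim_inl, one_smul]
    rw [hp' m hm, ← hRc m, ← map_add, show Y₀ + Y₀ * E = Y₀ * (1 + E) by ring]
    exact (coeff_newton_expODE hninvS w y Y₀ Q (2 ^ i) hM1 hy hR hQ m (by omega)).symm

/-- Gate count of `J` doubling steps for `y' = w y` from precision `1` to `2^J`. [cite: Brent1976, §6] -/
def expCost : ℕ → ℕ
  | 0 => 0
  | J + 1 => expCost J + expStepCost J

/-- `expCost J ≤ (72 J + 251) 2^{J+1}`. [cite: Brent1976, §6] -/
theorem expCost_le (J : ℕ) : expCost J ≤ (72 * J + 251) * 2 ^ (J + 1) := by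
  induction J with
  | zero => simp [expCost]
  | succ J ih =>
    have h := expStepCost_le J
    have h2 : (72 * J + 251) * 2 ^ (J + 1) = 2 * ((72 * J + 251) * 2 ^ J) := by ring
    rw [expCost, show (72 * (J + 1) + 251) * 2 ^ (J + 1 + 1) =
      (72 * J + 251) * 2 ^ (J + 1) + (72 * J + 251) * 2 ^ (J + 1) + 144 * 2 ^ (J + 1) by ring, h2]
    rw [h2] at ih
    omega

/-- **The exponential / `y' = w y` by Newton doubling as a circuit**: the first `2^J` coefficients of
the solution `y` (`y' = w y`, `y(0) = 1`) are jointly computed within `expCost J ≤ (72J + 251)2^{J+1}`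
further gates, given the first `2^J` coefficients of `w`. [cite: Brent1976, §6] -/
theorem jointlyComputed_expODE (ζ tinv : ℕ → k)
    (hζ : ∀ κ, κ ≠ 0 → ζ κ ^ 2 ^ (κ - 1) = -1) (ht : ∀ κ, (2 ^ κ : k) * tinv κ = 1)
    (ninv : ℕ → k) (hninv : ∀ j : ℕ, ((j : k) + 1) * ninv j = 1)
    (w y : (MvPolynomial τ k)⟦X⟧) (hy : derivativeFun y = w * y) (hy0 : coeff 0 y = 1) :
    ∀ (J : ℕ) {ι : Type ww} (v : ι → MvPolynomial τ k) (s : ℕ) (eW : Fin (2 ^ J) → ι),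
      JointlyComputed v s → (∀ j, v (eW j) = coeff j w) →
      JointlyComputed (Sum.elim v (fun m : Fin (2 ^ J) => coeff m y)) (s + expCost J)
  | 0, ι, v, s, eW, hv, heW => by
    rw [expCost, Nat.add_zero]
    refine hv.of_mem _ ?_
    rintro (x | m)
    · exact Or.inl ⟨x, rfl⟩
    · refine Or.inr (Or.inr ⟨1, ?_⟩)
      simp [hy0]
  | J + 1, ι, v, s, eW, hv, heW => by
    have hle : 2 ^ J ≤ 2 ^ (J + 1) := Nat.pow_le_pow_right (by norm_num) (by omega)
    have ih := jointlyComputed_expODE ζ tinv hζ ht ninv hninv w y hy hy0 J v s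
      (fun j => eW ⟨j, lt_of_lt_of_le j.isLt hle⟩) hv (fun j => heW _)
    have hstep := jointlyComputed_expODE_step ζ tinv hζ ht ninv hninv ih w y hy hy0 J
      (fun j => Sum.inl (eW j)) (fun j => by simp [heW]) (fun j => Sum.inr j) (fun j => rfl)
    rw [expCost, ← Nat.add_assoc]
    refine hstep.of_mem _ ?_
    rintro (x | m)
    · exact Or.inl ⟨Sum.inl (Sum.inl x), rfl⟩
    · exact Or.inl ⟨Sum.inr m, rfl⟩

end ExpODECircuit

end Literature.Computability.AlgebraicComplexity

end
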